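import Literature.AlgebraicGeometry.Frobenioids.Cor411OfPreStepsData
import Literature.AlgebraicGeometry.Frobenioids.Cor411iiOfThm34ii
import Literature.AlgebraicGeometry.Frobenioids.EquivalencePreStepsFSMFF2008Assembly
import HarnessLib

/-!
# Frobenioids I, Corollary 4.11 (ii)(iii)(iv) AS TYPED, in print's generality — UNCONDITIONAL closers with
# NO hypothesis on the base categories beyond print's standard type (Def. 3.1 (i)(d))

Mochizuki, *The geometry of Frobenioids I: the general theory*, Kyushu J. Math. **62** (2008)
293–400, kurims text: Cor. 4.11 (ii), (iii), (iv) pp. 91–92, proof pp. 92–94 [cite: MochizukiFrdI2008, Cor. 4.11 (iv) p.92];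
Theorem 3.4 (ii) p. 62 ("`Ψ` preserves pre-steps … group-like objects" for bases of FSMFF-type = standard type,
clause (d) of Def. 3.1 (i)); Theorem 4.9 pp. 88–90.

PROOF-ONLY file (cell abc-iut, layer L1, seat abc-iut-L1-d6; rows `FrdI:Cor4.11(ii)`, `FrdI:Cor4.11(iii)`,
`FrdI:Cor4.11(iv)`; sub-DAG `plan/L1/SUBDAG-FrdI-Cor411.md`). The assembly of three kernel facts BY NAME:
(1) Thm. 3.4 (ii) AS PRINTED for every pair of Frobenioids — seat abc-iut-L1-t11/t13's `FrdI.thm34ii_ofFunctor`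
(`EquivalencePreStepsFSMFF2008Assembly.lean`, over seat abc-iut-L1-t13's 2008-FSMFF core); (2) Cor. 4.11 (ii) AS
TYPED from the typed Thm. 3.4 (ii) for `Ψ`, `Ψ⁻¹` — seat abc-iut-L1-d6's `PreFrobenioid.cor411ii_ofFunctor_of_thm34ii`
(`Cor411iiOfThm34ii.lean`); (3) Cor. 4.11 (iii)/(iv) AS TYPED from (ii) and the conclusion of Thm. 3.4 (ii) —
seat abc-iut-L1-d6's `Cor411OfPreSteps.lean` / `Cor411OfPreStepsData.lean`.

* `FrdI.cor411ii_ofFunctor` — **the typed Cor. 4.11 (ii) for EVERY pair of Frobenioids `C_i → F_{Φ_i}` with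
  perf-factorial `Φ_i` and EVERY equivalence `Ψ`** (its only antecedent is the typed `Cor411Setting`: Div-slim
  bases, standard type, `HypB`);
* `FrdI.cor411iii_ofFunctor` / `FrdI.cor411iv_ofFunctor` — **the typed Cor. 4.11 (iii) / (iv) for every such pair,
  every `Ψ`, arbitrary `R_i : RSParams`, with "`C₁` of rational type" read at THE birationalization / support**
  (`hrat₁`, the rationality conjunct of "rationally standard" at the constructions); `…_of_thm34ii` = the same
  from the typed Thm. 3.4 (ii) for `Ψ`, `Ψ⁻¹`;
* `FrdI.preservesDegFr_of_cor411Setting` / `FrdI.exists_divisorMonoidIsoOver_div_ofFunctor` — degrees and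
  Thm. 4.9's `Ψ^Φ` with its divisor clause under `Cor411Setting`, unconditionally;
* `FrdI.exists_cor411iv_data_ofFunctor` — the data `(Ψ^Base, η, Ψ^Φ)` of (iv) with the divisor formula on all
  arrows, the typed rigidity clause `Cor411ivRigid` and the slim-base rigidity clause, for the consumers
  ([FrdI] Thm. 6.4, [FrdII], [EtTh] §3–§5, [IUTchI]);
* `FrdI.exists_cor411iii_compat_ofFunctor` — (iii) WITH its compatibility clause with `Ψ^Prime`, isotropic
  non-group-like case (`Thm42Setting`).

Hypotheses left: Frobenioids; `Φ_i` perf-factorial (§4 standing assumption, p. 75); for (iii)/(iv) `hrat₁`; the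
typed antecedents themselves. NO hypothesis on `D_i` beyond print's (Def. 3.1 (i)(d): FSMFF-type, inside standard
type). No new definitions; no statement of the paper is restated or strengthened; nothing here is specific to the
abc programme and no side is taken on [IUTchIII] Cor. 3.12.
-/

namespace Literature.AlgebraicGeometry.Frobenioids

open CategoryTheory Opposite

universe w v v' u u'

namespace FrdI

open PreFrobenioid

variable {D₁ : Type u} [Category.{v} D₁] {Φ₁ : D₁ᵒᵖ ⥤ CommMonCat.{w}} {C₁ : Type u'} [Category.{v'} C₁]
  {D₂ : Type u} [Category.{v} D₂] {Φ₂ : D₂ᵒᵖ ⥤ CommMonCat.{w}} {C₂ : Type u'} [Category.{v'} C₂]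
  {F₁ : C₁ ⥤ ElemFrobenioid Φ₁} {F₂ : C₂ ⥤ ElemFrobenioid Φ₂}

/-! ### Cor. 4.11 (ii) -/

/-- **[FrdI] Cor. 4.11 (ii) AS TYPED, for EVERY pair of Frobenioids with perf-factorial `Φ_i` and EVERY
equivalence `Ψ`** (p. 91: a `1`-unique `Ψ^Base : D₁ ⥲ D₂` under `Ψ`; rigid composites for slim bases): the typed
Thm. 3.4 (ii) for `Ψ` and `Ψ⁻¹` (`FrdI.thm34ii_ofFunctor`, 2008 FSMFF wording) fed to seat abc-iut-L1-d6's
`PreFrobenioid.cor411ii_ofFunctor_of_thm34ii`. [cite: MochizukiFrdI2008, Cor. 4.11 (ii) p.91] -/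
theorem cor411ii_ofFunctor (hF₁ : IsFrobenioid F₁) (hF₂ : IsFrobenioid F₂) (Ψ : C₁ ≌ C₂)
    (hpf₁ : Objectwise (fun M _ => IsPerfFactorial M) Φ₁) (hpf₂ : Objectwise (fun M _ => IsPerfFactorial M) Φ₂) :
    (PreFrobenioidData.ofFunctor Φ₁ F₁).Cor411ii (PreFrobenioidData.ofFunctor Φ₂ F₂) Ψ :=
  cor411ii_ofFunctor_of_thm34ii hF₁ hF₂ Ψ hpf₁ hpf₂ (FrdI.thm34ii_ofFunctor hF₁ hF₂ Ψ)
    (FrdI.thm34ii_ofFunctor hF₂ hF₁ Ψ.symm)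

/-! ### Cor. 4.11 (iii), (iv) -/

/-- **[FrdI] Cor. 4.11 (iii) AS TYPED from Thm. 3.4 (ii) AS TYPED** (for `Ψ` and `Ψ⁻¹`), Frobenioids with
perf-factorial `Φ_i`, `C₁` of rational type at THE birationalization / support; NO hypothesis on the bases (the
typed (ii) is `PreFrobenioid.cor411ii_ofFunctor_of_thm34ii`). [cite: MochizukiFrdI2008, Cor. 4.11 (iii) p.92] -/
theorem cor411iii_ofFunctor_of_thm34ii (hF₁ : IsFrobenioid F₁) (hF₂ : IsFrobenioid F₂)
    (hpf₁ : Objectwise (fun M _ => IsPerfFactorial M) Φ₁) (hpf₂ : Objectwise (fun M _ => IsPerfFactorial M) Φ₂)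
    (hrat₁ : ∀ A : C₁, PreFrobenioidData.IsRational
      (biratData hF₁ (hasBiratSquares_of_isFrobenioid hF₁))
      (S := PreFrobenioidData.ofFunctor Φ₁ F₁) (fun a 𝔭 => PrimarySupp a 𝔭) A)
    (Ψ : C₁ ≌ C₂) (R₁ : (PreFrobenioidData.ofFunctor Φ₁ F₁).RSParams)
    (R₂ : (PreFrobenioidData.ofFunctor Φ₂ F₂).RSParams)
    (h : (PreFrobenioidData.ofFunctor Φ₁ F₁).Thm34ii (PreFrobenioidData.ofFunctor Φ₂ F₂) Ψ)
    (h' : (PreFrobenioidData.ofFunctor Φ₂ F₂).Thm34ii (PreFrobenioidData.ofFunctor Φ₁ F₁) Ψ.symm) :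
    (PreFrobenioidData.ofFunctor Φ₁ F₁).Cor411iii (PreFrobenioidData.ofFunctor Φ₂ F₂) Ψ R₁ R₂ :=
  cor411iii_ofFunctor_of_cor411ii_of_thm34ii hF₁ hF₂ hpf₁ hpf₂ hrat₁ Ψ R₁ R₂ h h'
    (cor411ii_ofFunctor_of_thm34ii hF₁ hF₂ Ψ hpf₁ hpf₂ h h')

/-- **[FrdI] Cor. 4.11 (iv) AS TYPED from Thm. 3.4 (ii) AS TYPED** (for `Ψ` and `Ψ⁻¹`), Frobenioids with
perf-factorial `Φ_i`, `C₁` of rational type at THE birationalization / support; NO hypothesis on the bases.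
[cite: MochizukiFrdI2008, Cor. 4.11 (iv) p.92] -/
theorem cor411iv_ofFunctor_of_thm34ii (hF₁ : IsFrobenioid F₁) (hF₂ : IsFrobenioid F₂)
    (hpf₁ : Objectwise (fun M _ => IsPerfFactorial M) Φ₁) (hpf₂ : Objectwise (fun M _ => IsPerfFactorial M) Φ₂)
    (hrat₁ : ∀ A : C₁, PreFrobenioidData.IsRational
      (biratData hF₁ (hasBiratSquares_of_isFrobenioid hF₁))
      (S := PreFrobenioidData.ofFunctor Φ₁ F₁) (fun a 𝔭 => PrimarySupp a 𝔭) A)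
    (Ψ : C₁ ≌ C₂) (R₁ : (PreFrobenioidData.ofFunctor Φ₁ F₁).RSParams)
    (R₂ : (PreFrobenioidData.ofFunctor Φ₂ F₂).RSParams)
    (h : (PreFrobenioidData.ofFunctor Φ₁ F₁).Thm34ii (PreFrobenioidData.ofFunctor Φ₂ F₂) Ψ)
    (h' : (PreFrobenioidData.ofFunctor Φ₂ F₂).Thm34ii (PreFrobenioidData.ofFunctor Φ₁ F₁) Ψ.symm) :
    (PreFrobenioidData.ofFunctor Φ₁ F₁).Cor411iv (PreFrobenioidData.ofFunctor Φ₂ F₂) Ψ R₁ R₂ :=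
  cor411iv_ofFunctor_of_cor411ii_of_thm34ii hF₁ hF₂ hpf₁ hpf₂ hrat₁ Ψ R₁ R₂ h h'
    (cor411ii_ofFunctor_of_thm34ii hF₁ hF₂ Ψ hpf₁ hpf₂ h h')

/-- **[FrdI] Cor. 4.11 (iii) AS TYPED, in print's generality** ("there exists an isomorphism of functors
`Ψ^Φ : Φ₁ ⥲ Φ₂` lying over the equivalence `Ψ^Base`", p. 92): for EVERY pair of Frobenioids `C_i → F_{Φ_i}`
with perf-factorial `Φ_i`, EVERY equivalence `Ψ`, arbitrary `R_i`, and `C₁` of rational type at THE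
birationalization / support — NO hypothesis on the base categories: Thm. 3.4 (ii) as printed
(`FrdI.thm34ii_ofFunctor`) fed to `cor411iii_ofFunctor_of_thm34ii`. [cite: MochizukiFrdI2008, Cor. 4.11 (iii) p.92] -/
theorem cor411iii_ofFunctor (hF₁ : IsFrobenioid F₁) (hF₂ : IsFrobenioid F₂)
    (hpf₁ : Objectwise (fun M _ => IsPerfFactorial M) Φ₁) (hpf₂ : Objectwise (fun M _ => IsPerfFactorial M) Φ₂)
    (hrat₁ : ∀ A : C₁, PreFrobenioidData.IsRational
      (biratData hF₁ (hasBiratSquares_of_isFrobenioid hF₁))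
      (S := PreFrobenioidData.ofFunctor Φ₁ F₁) (fun a 𝔭 => PrimarySupp a 𝔭) A)
    (Ψ : C₁ ≌ C₂) (R₁ : (PreFrobenioidData.ofFunctor Φ₁ F₁).RSParams)
    (R₂ : (PreFrobenioidData.ofFunctor Φ₂ F₂).RSParams) :
    (PreFrobenioidData.ofFunctor Φ₁ F₁).Cor411iii (PreFrobenioidData.ofFunctor Φ₂ F₂) Ψ R₁ R₂ :=
  cor411iii_ofFunctor_of_thm34ii hF₁ hF₂ hpf₁ hpf₂ hrat₁ Ψ R₁ R₂ (FrdI.thm34ii_ofFunctor hF₁ hF₂ Ψ)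
    (FrdI.thm34ii_ofFunctor hF₂ hF₁ Ψ.symm)

/-- **[FrdI] Cor. 4.11 (iv) AS TYPED, in print's generality** (Category-theoreticity of the functor to an
elementary Frobenioid: "a 1-commutative diagram `Ψ^F ∘ (C₁ → F_{Φ₁}) ≅ (C₂ → F_{Φ₂}) ∘ Ψ`", p. 92): for EVERY
pair of Frobenioids `C_i → F_{Φ_i}` with perf-factorial `Φ_i`, EVERY equivalence `Ψ`, arbitrary `R_i`, and `C₁`
of rational type at THE birationalization / support — NO hypothesis on the base categories.
[cite: MochizukiFrdI2008, Cor. 4.11 (iv) p.92] -/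
theorem cor411iv_ofFunctor (hF₁ : IsFrobenioid F₁) (hF₂ : IsFrobenioid F₂)
    (hpf₁ : Objectwise (fun M _ => IsPerfFactorial M) Φ₁) (hpf₂ : Objectwise (fun M _ => IsPerfFactorial M) Φ₂)
    (hrat₁ : ∀ A : C₁, PreFrobenioidData.IsRational
      (biratData hF₁ (hasBiratSquares_of_isFrobenioid hF₁))
      (S := PreFrobenioidData.ofFunctor Φ₁ F₁) (fun a 𝔭 => PrimarySupp a 𝔭) A)
    (Ψ : C₁ ≌ C₂) (R₁ : (PreFrobenioidData.ofFunctor Φ₁ F₁).RSParams)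
    (R₂ : (PreFrobenioidData.ofFunctor Φ₂ F₂).RSParams) :
    (PreFrobenioidData.ofFunctor Φ₁ F₁).Cor411iv (PreFrobenioidData.ofFunctor Φ₂ F₂) Ψ R₁ R₂ :=
  cor411iv_ofFunctor_of_thm34ii hF₁ hF₂ hpf₁ hpf₂ hrat₁ Ψ R₁ R₂ (FrdI.thm34ii_ofFunctor hF₁ hF₂ Ψ)
    (FrdI.thm34ii_ofFunctor hF₂ hF₁ Ψ.symm)

/-! ### Degrees, `Ψ^Φ` with its divisor clause, the data form and the compatibility clause -/

/-- **"`Ψ` preserves Frobenius degrees" under the hypotheses of Cor. 4.11, unconditionally** (Thm. 3.4 (iii);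
p. 94): for every pair of Frobenioids and every `Ψ` satisfying the typed `Cor411Setting`.
[cite: MochizukiFrdI2008, Cor. 4.11 (iv) p.92] -/
theorem preservesDegFr_of_cor411Setting (hF₁ : IsFrobenioid F₁) (hF₂ : IsFrobenioid F₂) (Ψ : C₁ ≌ C₂)
    (hs : (PreFrobenioidData.ofFunctor Φ₁ F₁).Cor411Setting (PreFrobenioidData.ofFunctor Φ₂ F₂) Ψ) :
    PreFrobenioidData.PreservesDegFr (PreFrobenioidData.ofFunctor Φ₁ F₁) (PreFrobenioidData.ofFunctor Φ₂ F₂) Ψ := by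
  obtain ⟨h₁₂, -, hG⟩ := FrdI.thm34ii_ofFunctor hF₁ hF₂ Ψ hs.standard.1.quasiIsotropic
    hs.standard.2.quasiIsotropic hs.standard.1.fsmff hs.standard.2.fsmff
  obtain ⟨h₂₁, -, hG'⟩ := FrdI.thm34ii_ofFunctor hF₂ hF₁ Ψ.symm hs.standard.2.quasiIsotropic
    hs.standard.1.quasiIsotropic hs.standard.2.fsmff hs.standard.1.fsmff
  exact preservesDegFr_of_cor411Setting_of_preservesPreSteps hF₁ hF₂ Ψ h₁₂ h₂₁ hG hG' hs

/-- **Thm. 4.9's `Ψ^Φ : Φ₁ ⥲ Φ₂` over `Ψ` WITH `Ψ^Φ_A(Div φ) = Div(Ψ φ)` on ALL arrows, under the hypotheses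
of Cor. 4.11, unconditionally** (every case; NO base hypothesis): Frobenioids with perf-factorial `Φ_i`, `C₁` of
rational type at THE birationalization / support. [cite: MochizukiFrdI2008, Thm. 4.9 p.89] -/
theorem exists_divisorMonoidIsoOver_div_ofFunctor (hF₁ : IsFrobenioid F₁) (hF₂ : IsFrobenioid F₂)
    (hpf₁ : Objectwise (fun M _ => IsPerfFactorial M) Φ₁) (hpf₂ : Objectwise (fun M _ => IsPerfFactorial M) Φ₂)
    (hrat₁ : ∀ A : C₁, PreFrobenioidData.IsRational
      (biratData hF₁ (hasBiratSquares_of_isFrobenioid hF₁))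
      (S := PreFrobenioidData.ofFunctor Φ₁ F₁) (fun a 𝔭 => PrimarySupp a 𝔭) A)
    (Ψ : C₁ ≌ C₂) (hs : (PreFrobenioidData.ofFunctor Φ₁ F₁).Cor411Setting (PreFrobenioidData.ofFunctor Φ₂ F₂) Ψ) :
    ∃ E : (PreFrobenioidData.ofFunctor Φ₁ F₁).DivisorMonoidIsoOver (PreFrobenioidData.ofFunctor Φ₂ F₂) Ψ,
      ∀ ⦃A B : C₁⦄ (φ : A ⟶ B), E.iso A (Div F₁ φ) = Div F₂ (Ψ.functor.map φ) := by
  obtain ⟨h₁₂, -, hG⟩ := FrdI.thm34ii_ofFunctor hF₁ hF₂ Ψ hs.standard.1.quasiIsotropic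
    hs.standard.2.quasiIsotropic hs.standard.1.fsmff hs.standard.2.fsmff
  obtain ⟨h₂₁, -, hG'⟩ := FrdI.thm34ii_ofFunctor hF₂ hF₁ Ψ.symm hs.standard.2.quasiIsotropic
    hs.standard.1.quasiIsotropic hs.standard.2.fsmff hs.standard.1.fsmff
  exact exists_divisorMonoidIsoOver_div_of_cor411Setting_of_preservesPreSteps hF₁ hF₂ hpf₁ hpf₂ hrat₁ Ψ h₁₂ h₂₁
    hG hG' hs

/-- **[FrdI] Cor. 4.11 (iv) for CONSUMERS, unconditionally** — the data `(Ψ^Base, η, Ψ^Φ)` with the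
`1`-unique base square, "`Ψ` preserves Frobenius degrees", the divisor formula `Div(Ψ φ) = η_A^* Ψ^Φ(Div φ)`
on ALL arrows, the typed rigidity clause `Cor411ivRigid` and the slim-base rigidity clause — for EVERY pair of
Frobenioids with perf-factorial `Φ_i` and EVERY `Ψ` under the typed `Cor411Setting`, `C₁` of rational type at
THE birationalization / support; NO hypothesis on the base categories. [cite: MochizukiFrdI2008, Cor. 4.11 (iv) p.92] -/
theorem exists_cor411iv_data_ofFunctor (hF₁ : IsFrobenioid F₁) (hF₂ : IsFrobenioid F₂)
    (hpf₁ : Objectwise (fun M _ => IsPerfFactorial M) Φ₁) (hpf₂ : Objectwise (fun M _ => IsPerfFactorial M) Φ₂)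
    (hrat₁ : ∀ A : C₁, PreFrobenioidData.IsRational
      (biratData hF₁ (hasBiratSquares_of_isFrobenioid hF₁))
      (S := PreFrobenioidData.ofFunctor Φ₁ F₁) (fun a 𝔭 => PrimarySupp a 𝔭) A)
    (Ψ : C₁ ≌ C₂) (hs : (PreFrobenioidData.ofFunctor Φ₁ F₁).Cor411Setting (PreFrobenioidData.ofFunctor Φ₂ F₂) Ψ) :
    ∃ (ΨBase : D₁ ⥤ D₂)
      (E' : (PreFrobenioidData.ofFunctor Φ₁ F₁).DivisorMonoidIsoOverBase (PreFrobenioidData.ofFunctor Φ₂ F₂) ΨBase)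
      (η : Ψ.functor ⋙ (PreFrobenioidData.ofFunctor Φ₂ F₂).base ≅ (PreFrobenioidData.ofFunctor Φ₁ F₁).base ⋙ ΨBase),
      PreFrobenioidData.OneUniqueSquare Ψ.functor (PreFrobenioidData.ofFunctor Φ₁ F₁).base
        (PreFrobenioidData.ofFunctor Φ₂ F₂).base ΨBase ∧
      PreFrobenioidData.PreservesDegFr (PreFrobenioidData.ofFunctor Φ₁ F₁) (PreFrobenioidData.ofFunctor Φ₂ F₂) Ψ ∧
      (∀ ⦃A B : C₁⦄ (φ : A ⟶ B),
        Div F₂ (Ψ.functor.map φ) = pull Φ₂ (η.hom.app A) (E'.iso (baseObj F₁ A) (Div F₁ φ))) ∧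
      (PreFrobenioidData.ofFunctor Φ₁ F₁).Cor411ivRigid (PreFrobenioidData.ofFunctor Φ₂ F₂) Ψ ΨBase E' ∧
      (IsSlim D₁ → IsSlim D₂ → IsRigidFunctor (Ψ.functor ⋙ (PreFrobenioidData.ofFunctor Φ₂ F₂).base) ∧
        IsRigidFunctor ((PreFrobenioidData.ofFunctor Φ₁ F₁).base ⋙ ΨBase)) := by
  obtain ⟨h₁₂, -, hG⟩ := FrdI.thm34ii_ofFunctor hF₁ hF₂ Ψ hs.standard.1.quasiIsotropic
    hs.standard.2.quasiIsotropic hs.standard.1.fsmff hs.standard.2.fsmff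
  obtain ⟨h₂₁, -, hG'⟩ := FrdI.thm34ii_ofFunctor hF₂ hF₁ Ψ.symm hs.standard.2.quasiIsotropic
    hs.standard.1.quasiIsotropic hs.standard.2.fsmff hs.standard.1.fsmff
  exact exists_cor411iv_data_ofFunctor_of_cor411ii_of_preservesPreSteps hF₁ hF₂ hpf₁ hpf₂ hrat₁ Ψ h₁₂ h₂₁ hG hG'
    hs (cor411ii_ofFunctor hF₁ hF₂ Ψ hpf₁ hpf₂)

/-- **[FrdI] Cor. 4.11 (iii) WITH its compatibility clause, unconditionally**, for Frobenioids of isotropic,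
non-group-like type (`Thm42Setting`) with perf-factorial `Φ_i`, `C₁` of rational type at THE birationalization /
support, under the typed `Cor411Setting`; NO hypothesis on the base categories ("compatible … with the
isomorphism `Ψ^Prime` of Theorem 4.2, (ii)", p. 92). [cite: MochizukiFrdI2008, Cor. 4.11 (iii) p.92] -/
theorem exists_cor411iii_compat_ofFunctor (hF₁ : IsFrobenioid F₁) (hF₂ : IsFrobenioid F₂)
    (hpf₁ : Objectwise (fun M _ => IsPerfFactorial M) Φ₁) (hpf₂ : Objectwise (fun M _ => IsPerfFactorial M) Φ₂)
    (hrat₁ : ∀ A : C₁, PreFrobenioidData.IsRational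
      (biratData hF₁ (hasBiratSquares_of_isFrobenioid hF₁))
      (S := PreFrobenioidData.ofFunctor Φ₁ F₁) (fun a 𝔭 => PrimarySupp a 𝔭) A)
    (Ψ : C₁ ≌ C₂)
    (hT : PreFrobenioidData.Thm42Setting (PreFrobenioidData.ofFunctor Φ₁ F₁) (PreFrobenioidData.ofFunctor Φ₂ F₂))
    (hs : (PreFrobenioidData.ofFunctor Φ₁ F₁).Cor411Setting (PreFrobenioidData.ofFunctor Φ₂ F₂) Ψ) :
    ∃ (e : ∀ A : C₁, Primes (Φ₁.obj (op (baseObj F₁ A))) ≃ Primes (Φ₂.obj (op (baseObj F₂ (Ψ.functor.obj A)))))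
      (E : (PreFrobenioidData.ofFunctor Φ₁ F₁).DivisorMonoidIsoOver (PreFrobenioidData.ofFunctor Φ₂ F₂) Ψ)
      (ΨBase : D₁ ⥤ D₂)
      (η : Ψ.functor ⋙ (PreFrobenioidData.ofFunctor Φ₂ F₂).base ≅ (PreFrobenioidData.ofFunctor Φ₁ F₁).base ⋙ ΨBase)
      (E' : (PreFrobenioidData.ofFunctor Φ₁ F₁).DivisorMonoidIsoOverBase (PreFrobenioidData.ofFunctor Φ₂ F₂) ΨBase)
      (e' : ∀ X : D₁, Primes (Φ₁.obj (op X)) ≃ Primes (Φ₂.obj (op (ΨBase.obj X)))),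
      (∀ (A : C₁) (𝔭 : Primes (Φ₁.obj (op (baseObj F₁ A)))),
        (∀ ⦃B : C₁⦄ (φ : A ⟶ B), IsCoAngularPreStep F₁ φ →
            (Div F₁ φ ∈ 𝔭.submonoid ↔ Div F₂ (Ψ.functor.map φ) ∈ (e A 𝔭).submonoid)) ∧
        ∀ ⦃B : C₁⦄ (ψ : B ⟶ A), IsCoAngularPreStep F₁ ψ →
          ((∃ y ∈ 𝔭.submonoid, pull Φ₁ (Base F₁ ψ) y = Div F₁ ψ) ↔
            ∃ y ∈ (e A 𝔭).submonoid, pull Φ₂ (Base F₂ (Ψ.functor.map ψ)) y = Div F₂ (Ψ.functor.map ψ))) ∧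
      (PreFrobenioidData.ofFunctor Φ₁ F₁).Thm49_compat (PreFrobenioidData.ofFunctor Φ₂ F₂) Ψ E e ∧
      PreFrobenioidData.OneUniqueSquare Ψ.functor (PreFrobenioidData.ofFunctor Φ₁ F₁).base
        (PreFrobenioidData.ofFunctor Φ₂ F₂).base ΨBase ∧
      (∀ (A : C₁) (x : Φ₁.obj (op (baseObj F₁ A))), E'.iso (baseObj F₁ A) x = pull Φ₂ (η.inv.app A) (E.iso A x)) ∧
      (PreFrobenioidData.ofFunctor Φ₁ F₁).Cor411iii_compat (PreFrobenioidData.ofFunctor Φ₂ F₂) E' e' := by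
  obtain ⟨h₁₂, -, -⟩ := FrdI.thm34ii_ofFunctor hF₁ hF₂ Ψ hs.standard.1.quasiIsotropic
    hs.standard.2.quasiIsotropic hs.standard.1.fsmff hs.standard.2.fsmff
  obtain ⟨h₂₁, -, -⟩ := FrdI.thm34ii_ofFunctor hF₂ hF₁ Ψ.symm hs.standard.2.quasiIsotropic
    hs.standard.1.quasiIsotropic hs.standard.2.fsmff hs.standard.1.fsmff
  exact exists_cor411iii_compat_ofFunctor_of_cor411ii_of_preservesPreSteps hF₁ hF₂ hpf₁ hpf₂ hrat₁ Ψ hT hs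
    (fun _ _ φ h => h₁₂ φ h) (fun _ _ φ h => h₂₁ φ h) (cor411ii_ofFunctor hF₁ hF₂ Ψ hpf₁ hpf₂)

end FrdI

end Literature.AlgebraicGeometry.Frobenioids
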